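import Literature.Analysis.FluidPDE.SlicedLocalEnergy
import Literature.Analysis.FluidPDE.DistributionalToWeak
import HarnessLib

/-!
# Jia–Šverák 2014, towards Thm. 3.2: slicing a tested energy inequality from the initial time

Analysis/FluidPDE proofs file (theorems only, no new definitions, no new named facts), part of
the proof of the named fact `Literature.Analysis.FluidPDE.jia_sverak_2014_theorem_3_2`
(`JiaSverak2014LocalRegularity.lean`; H. Jia, V. Šverák, Invent. Math. 196 (2014) =
arXiv:1204.0529, §3 Thm. 3.2). In the printed proof of Thm. 3.1 (arXiv p. 8) the local energy
inequality for the perturbation `v = u - a` is used **from the initial time**, where `v` has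
zero datum near the centre ("`lim_{t→0+} ‖v(·,t)‖_{L²(B_{4/3}(x₀))} = 0`, we can derive the local
energy inequality for `v`", and then "`∫_{B_{4/3}} |v|²φ(x,t) + ∫₀ᵗ∫ |∇v|²φ ≤ …` for
`t ∈ (0,T₂)`"). The perturbed inequality is available only against space–time test functions
compactly supported in the open slab (`JiaSverak2014.perturbed_local_energy_inequality`); the
passage to a.e. time slice and down to `t = 0` is the same measure theory as for the Leray
solution itself (the tree's `IsSuitableWeakSolutionOn.ae_localEnergy_slice` — top cut-off at a
Lebesgue point — and `IsLocalLeraySolution.ae_lintegral_sq_mul_add_grad_le_datum_add` — bottom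
cut-off through the initial condition). This file isolates that argument in **abstract form**,
so that it applies to `v` (which is not a suitable weak solution of any system in the tree):

* `ae_energy_slice_from_initial` — let `W, R` be integrable on `(0,T₀) × X`, `W ≥ 0`, `D ≥ 0`
  measurable and integrable on `[a,b] × X` for `0 < a ≤ b < T₀`, `U(t) = ∫ W(t,·) → L` as `t → 0⁺`
  in the a.e. sense, and suppose that for every smooth `0 ≤ χ ≤ 1` compactly supported in
  `(0,T₀)`: `2 ∫∫ χ D ≤ ∫∫ (χ' W + χ R)` (the tested inequality with `Φ = χ(t)ψ(x)`, where
  `W = |v|²ψ`, `D = ν|∇v|²ψ`, `R` the flux). Then for a.e. `s ∈ (0,T₀)`,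
  `U(s) + 2 ∫∫_{(0,s)×X} D ≤ L + ∫∫_{(0,s)×X} R` (in `ℝ≥0∞`, the dissipation as a lower integral).

## Mathlib / tree search

Tree: `exists_time_cutoff`, `tendsto_integral_kernel_mul_of_lebesguePoint`,
`tendsto_cutoff_indicator` (`SlicedLocalEnergy`), `exists_smooth_time_cutoff`,
`exists_abs_le_of_eq_zero_off_Ioo`, `tendsto_setIntegral_mul_of_ae_tendsto`, `integrable_time_mul`
(`DistributionalToWeak`); no abstract form of the slicing (`lean search 'slice_from_initial|
energy_slice'`). Mathlib: `IsUnifLocDoublingMeasure.ae_tendsto_average_norm_sub`,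
`tendsto_integral_of_dominated_convergence`, `setLIntegral_iUnion_of_directed`,
`ofReal_integral_eq_lintegral_ofReal`, `Integrable.integral_prod_left`.

## References

* H. Jia, V. Šverák, Invent. Math. 196 (2014) = arXiv:1204.0529, §3, proof of Thm. 3.1 (p. 8).
  Bib key `JiaSverak2014`.
* L. Caffarelli, R. Kohn, L. Nirenberg, Comm. Pure Appl. Math. 35 (1982), §2 (2.5) and the
  sliced form used in Lemma 5.1. Bib key `CaffarelliKohnNirenberg1982`.
* P. G. Lemarié-Rieusset, *The Navier–Stokes Problem in the 21st Century* (2016), Prop. 14.1.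
  Bib key `LemarieRieusset2016`.
-/

noncomputable section

open MeasureTheory TopologicalSpace Set Function Filter Metric
open _root_.Topology
open scoped ENNReal NNReal

namespace Literature.Analysis.FluidPDE

namespace JiaSverak2014

variable {X : Type*} [MeasureSpace X] [SFinite (volume : Measure X)]

omit [SFinite (volume : Measure X)] in
/-- A time weight vanishing off `[a, b]` times a function integrable on `[a,b] × X` is integrable
on the whole space–time when the weight is bounded and continuous. [folklore] -/
theorem integrable_timeWeight_mul {F : ℝ × X → ℝ} {a b : ℝ} (hF : IntegrableOn F (Icc a b ×ˢ univ) volume)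
    {χ : ℝ → ℝ} (hχ : Continuous χ) {C : ℝ} (hC : ∀ t, |χ t| ≤ C) (h0 : ∀ t ∉ Icc a b, χ t = 0) :
    Integrable (fun z : ℝ × X => χ z.1 * F z) volume := by
  have h1 : IntegrableOn (fun z : ℝ × X => χ z.1 * F z) (Icc a b ×ˢ univ) volume :=
    Integrable.mono' (hF.norm.const_mul C)
      (((hχ.measurable.comp measurable_fst).aestronglyMeasurable).mul hF.1)
      (Eventually.of_forall fun z => by
        rw [norm_mul, Real.norm_eq_abs]
        exact mul_le_mul_of_nonneg_right (hC z.1) (norm_nonneg _))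
  refine h1.integrable_of_forall_notMem_eq_zero fun z hz => ?_
  have : z.1 ∉ Icc a b := fun h => hz ⟨h, mem_univ _⟩
  rw [h0 z.1 this, zero_mul]

omit [SFinite (volume : Measure X)] in
/-- Multiplying an integrable space–time integrand by a bounded continuous function of time keeps
it integrable (the tree's `integrable_time_mul`, for a general measurable space `X`). [folklore] -/
theorem integrable_time_mul' {F : ℝ × X → ℝ} (hF : Integrable F volume) {χ : ℝ → ℝ}
    (hχ : Continuous χ) {C : ℝ} (hC : ∀ t, |χ t| ≤ C) :
    Integrable (fun z : ℝ × X => χ z.1 * F z) volume := by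
  refine Integrable.mono' (hF.norm.const_mul C)
    (((hχ.measurable.comp measurable_fst).aestronglyMeasurable).mul hF.1) ?_
  filter_upwards with z
  rw [norm_mul, Real.norm_eq_abs]
  exact mul_le_mul_of_nonneg_right (hC z.1) (norm_nonneg _)

/-- **Slicing a tested energy inequality from the initial time** (abstract form of CKN's sliced
local energy inequality, (2.5) ⟹ Lemma 5.1, combined with the initial condition as in
Lemarié-Rieusset 2016, Prop. 14.1; the form in which Jia–Šverák 2014 use the local energy
inequality of the perturbation `v = u - a`, proof of Thm. 3.1, arXiv p. 8). Let `T₀ > 0`; let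
`W, R : ℝ × X → ℝ` be integrable on `(0,T₀) × X` with `W ≥ 0`; let `D ≥ 0` be measurable on
`(0,T₀) × X` and integrable on `[a,b] × X` whenever `0 < a`, `b < T₀`; suppose
`U(t) = ∫ W(t, x) dx → L` as `t → 0⁺` in the a.e. sense; and suppose that for every smooth
`χ : ℝ → [0,1]` with compact support inside `(0,T₀)`,
`2 ∫∫ χ(t) D ≤ ∫∫ (χ'(t) W + χ(t) R)` (integrals over `ℝ × X`). Then for a.e. `s ∈ (0, T₀)`,
`U(s) + 2 ∫∫_{(0,s)×X} D ≤ L + ∫∫_{(0,s)×X} R`, the dissipation written as a lower integral.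
Proof: `χ = η_m θ_n`, `η_m` a monotone cut-off vanishing near `t = 0` (`η_m' = ρ_m ≥ 0` a unit
kernel in `(δ_m, 3δ_m)`), `θ_n` a cut-off at `s` (`θ_n' = -k_n`, `k_n` a unit kernel to the left
of `s`); `n → ∞` at a Lebesgue point `s` of `U` (`∫ k_n U → U(s)`), then `m → ∞`
(`∫ ρ_m U → L`, dominated convergence for `R`, monotone convergence for `D`).
[cite: JiaSverak2014, §3 proof of Thm. 3.1 (arXiv p. 8)] [cite: CaffarelliKohnNirenberg1982, §2 (2.5)] -/
theorem ae_energy_slice_from_initial {T₀ : ℝ} (hT₀ : 0 < T₀) {W R D : ℝ × X → ℝ}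
    (hW : IntegrableOn W (Ioo 0 T₀ ×ˢ (univ : Set X)) volume)
    (hR : IntegrableOn R (Ioo 0 T₀ ×ˢ (univ : Set X)) volume)
    (hW0 : ∀ z, 0 ≤ W z) (hD0 : ∀ z, 0 ≤ D z)
    (hDm : AEStronglyMeasurable D (volume.restrict (Ioo 0 T₀ ×ˢ (univ : Set X))))
    (hD : ∀ a b : ℝ, 0 < a → b < T₀ → IntegrableOn D (Icc a b ×ˢ (univ : Set X)) volume)
    {L : ℝ}
    (hlim : ∀ ε > 0, ∃ τ > 0, ∀ᵐ t ∂(volume.restrict (Ioo 0 τ)), |(∫ x, W (t, x)) - L| ≤ ε)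
    (H : ∀ χ : ℝ → ℝ, ContDiff ℝ (⊤ : ℕ∞) χ → HasCompactSupport χ → tsupport χ ⊆ Ioo 0 T₀ →
      (∀ t, 0 ≤ χ t) → (∀ t, χ t ≤ 1) →
      2 * ∫ z : ℝ × X, χ z.1 * D z ≤ ∫ z : ℝ × X, (deriv χ z.1 * W z + χ z.1 * R z)) :
    ∀ᵐ s ∂(volume.restrict (Ioo 0 T₀)),
      ENNReal.ofReal (∫ x, W (s, x)) + 2 * ∫⁻ z in Ioo 0 s ×ˢ (univ : Set X), ENNReal.ofReal (D z) ≤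
        ENNReal.ofReal L + ENNReal.ofReal (∫ z in Ioo 0 s ×ˢ (univ : Set X), R z) := by
  -- ## the data extended by zero off `(0,T₀) × X`
  set S : Set (ℝ × X) := Ioo 0 T₀ ×ˢ (univ : Set X) with hS
  have hSm : MeasurableSet S := measurableSet_Ioo.prod MeasurableSet.univ
  set W₀ : ℝ × X → ℝ := S.indicator W with hW₀
  set R₀ : ℝ × X → ℝ := S.indicator R with hR₀
  set D₀ : ℝ × X → ℝ := S.indicator D with hD₀
  have hIW : Integrable W₀ volume := hW.integrable_indicator hSm
  have hIR : Integrable R₀ volume := hR.integrable_indicator hSm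
  have hW₀0 : ∀ z, 0 ≤ W₀ z := fun z => by
    simp only [hW₀]; exact indicator_nonneg (fun z _ => hW0 z) z
  have hD₀0 : ∀ z, 0 ≤ D₀ z := fun z => by
    simp only [hD₀]; exact indicator_nonneg (fun z _ => hD0 z) z
  have hWS : ∀ z ∈ S, W₀ z = W z := fun z hz => indicator_of_mem hz _
  have hRS : ∀ z ∈ S, R₀ z = R z := fun z hz => indicator_of_mem hz _
  have hDS : ∀ z ∈ S, D₀ z = D z := fun z hz => indicator_of_mem hz _
  have hD₀m : AEStronglyMeasurable D₀ volume := (aestronglyMeasurable_indicator_iff hSm).2 hDm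
  have hD₀I : ∀ a b : ℝ, 0 < a → b < T₀ → IntegrableOn D₀ (Icc a b ×ˢ (univ : Set X)) volume := by
    intro a b ha hb
    refine (hD a b ha hb).congr_fun (fun z hz => (hDS z ⟨⟨ha.trans_le hz.1.1, hz.1.2.trans_lt hb⟩,
      mem_univ _⟩).symm) (measurableSet_Icc.prod MeasurableSet.univ)
  -- the sliced energy `U`
  set U : ℝ → ℝ := fun t => ∫ x, W₀ (t, x) with hU
  have hprod : (volume : Measure (ℝ × X)) = (volume : Measure ℝ).prod (volume : Measure X) :=
    Measure.volume_eq_prod ℝ X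
  have hIW' : Integrable W₀ ((volume : Measure ℝ).prod (volume : Measure X)) := by rw [← hprod]; exact hIW
  have hIU : Integrable U (volume : Measure ℝ) := hIW'.integral_prod_left
  have hU0 : ∀ t, 0 ≤ U t := fun t => integral_nonneg fun x => hW₀0 (t, x)
  have hUW : ∀ t ∈ Ioo (0 : ℝ) T₀, U t = ∫ x, W (t, x) := fun t ht =>
    integral_congr_ae (Eventually.of_forall fun x => hWS (t, x) ⟨ht, mem_univ _⟩)
  have hlimU : ∀ ε > 0, ∃ τ > 0, ∀ᵐ t ∂(volume.restrict (Ioo 0 τ)), |U t - L| ≤ ε := by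
    intro ε hε
    obtain ⟨τ, hτ, h⟩ := hlim ε hε
    refine ⟨min τ T₀, lt_min hτ hT₀, ?_⟩
    have h' := ae_restrict_of_ae_restrict_of_subset (Ioo_subset_Ioo_right (min_le_left τ T₀)) h
    have hmem : ∀ᵐ t ∂(volume.restrict (Ioo 0 (min τ T₀))), t ∈ Ioo 0 (min τ T₀) :=
      ae_restrict_mem measurableSet_Ioo
    filter_upwards [h', hmem] with t ht htm
    rwa [hUW t ⟨htm.1, htm.2.trans_le (min_le_right _ _)⟩]
  -- ## bottom cut-offs at scale `δ m`
  set δ : ℕ → ℝ := fun m => T₀ / (8 * ((m : ℝ) + 1)) with hδ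
  have hδ0 : ∀ m, 0 < δ m := fun m => by positivity
  have hδle : ∀ m, δ m ≤ T₀ / 8 := fun m => by
    show T₀ / (8 * ((m : ℝ) + 1)) ≤ T₀ / 8
    exact div_le_div_of_nonneg_left hT₀.le (by norm_num) (by nlinarith [m.cast_nonneg (α := ℝ)])
  have hδT : ∀ m, 3 * δ m ≤ T₀ := fun m => by linarith [hδle m]
  have hδlim : Tendsto δ atTop (𝓝 0) := by
    have h1 : Tendsto (fun m : ℕ => (m : ℝ) + 1) atTop atTop :=
      tendsto_atTop_add_const_right _ 1 tendsto_natCast_atTop_atTop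
    exact tendsto_const_nhds.div_atTop (h1.const_mul_atTop (by norm_num))
  choose η ρ hηs hρc hηρ hη0 hη1 hη01 hρ0 hρsupp hρ1 using fun m => exists_smooth_time_cutoff (hδ0 m)
  have hηabs : ∀ m t, |η m t| ≤ 1 := fun m t => by
    rw [abs_le]; exact ⟨by linarith [(hη01 m t).1], (hη01 m t).2⟩
  have hρC : ∀ m, ∃ C, 0 ≤ C ∧ ∀ t, |ρ m t| ≤ C := fun m =>
    exists_abs_le_of_eq_zero_off_Ioo (hρc m) (hρsupp m)
  -- ## top cut-offs and Lebesgue points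
  obtain ⟨Ck, -, hcut⟩ := exists_time_cutoff
  have hLeb := IsUnifLocDoublingMeasure.ae_tendsto_average_norm_sub (μ := (volume : Measure ℝ))
    hIU.locallyIntegrable 2
  have hmeasI : ∀ s : ℝ, MeasurableSet {z : ℝ × X | z.1 < s} := fun s =>
    measurableSet_lt measurable_fst measurable_const
  -- ## the sliced inequality at level `m`, for a.e. `s ∈ (3δ_m, T₀)`
  have hlevel : ∀ᵐ s ∂(volume : Measure ℝ), ∀ m : ℕ, s ∈ Ioo (3 * δ m) T₀ →
      U s + 2 * ∫ z in Ioo (3 * δ m) s ×ˢ (univ : Set X), D₀ z ≤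
        (∫ t, ρ m t * U t) + ∫ z in {z : ℝ × X | z.1 < s}, η m z.1 * R₀ z := by
    filter_upwards [hLeb] with s hs m hsm
    have hs0 : 0 < s := lt_trans (by linarith [hδ0 m]) hsm.1
    -- the cut-off sequence at `s`
    set ε : ℕ → ℝ := fun n => 1 / ((n : ℝ) + 1) with hε
    have hεpos : ∀ n, 0 < ε n := fun n => Nat.one_div_pos_of_nat
    have hε0 : Tendsto ε atTop (𝓝 0) := tendsto_one_div_add_atTop_nhds_zero_nat
    choose θ k hθs hθ01 hθ1 hθ0 hθd hkc hkb hks hk1 using fun n => hcut s (ε n) (hεpos n)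
    -- the test weight `χ = η_m θ_n`
    have hχ : ∀ n, 2 * ∫ z : ℝ × X, (η m z.1 * θ n z.1) * D z ≤
        ∫ z : ℝ × X, ((ρ m z.1 * θ n z.1 - η m z.1 * k n z.1) * W z + (η m z.1 * θ n z.1) * R z) := by
      intro n
      have hsm' : ∀ t, η m t * θ n t ≠ 0 → t ∈ Ioo (δ m) (s - ε n / 2) := by
        intro t ht
        refine ⟨?_, ?_⟩
        · by_contra h
          exact ht (by rw [hη0 m t (not_lt.1 h), zero_mul])
        · by_contra h
          exact ht (by rw [hθ0 n t (not_lt.1 h), mul_zero])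
      have hsupp : tsupport (fun t => η m t * θ n t) ⊆ Ioo 0 T₀ := by
        refine (closure_minimal (fun t ht => ?_) isClosed_Icc).trans
          (Icc_subset_Ioo (hδ0 m) (by linarith [hεpos n, hsm.2]) :
            Icc (δ m) (s - ε n / 2) ⊆ Ioo 0 T₀)
        exact Ioo_subset_Icc_self (hsm' t ht)
      have hcs : HasCompactSupport fun t => η m t * θ n t :=
        HasCompactSupport.of_support_subset_isCompact isCompact_Icc
          (fun t ht => Ioo_subset_Icc_self (hsm' t ht))
      have hderiv : ∀ t, deriv (fun t => η m t * θ n t) t = ρ m t * θ n t - η m t * k n t := by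
        intro t
        have hd : HasDerivAt (fun t => η m t * θ n t) (ρ m t * θ n t + η m t * (-k n t)) t :=
          (hηρ m t).mul (hθd n t)
        rw [hd.deriv]
        ring
      have h := H (fun t => η m t * θ n t) ((hηs m).mul (hθs n)) hcs hsupp
        (fun t => mul_nonneg (hη01 m t).1 (hθ01 n t).1)
        (fun t => mul_le_one₀ (hη01 m t).2 (hθ01 n t).1 (hθ01 n t).2)
      simp only [hderiv] at h
      exact h
    -- ### integrable pieces
    obtain ⟨Cρ, hCρ0, hCρ⟩ := hρC m
    have hwb : ∀ n t, |η m t * θ n t| ≤ 1 := fun n t => by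
      rw [abs_mul, abs_of_nonneg (hη01 m t).1, abs_of_nonneg (hθ01 n t).1]
      exact mul_le_one₀ (hη01 m t).2 (hθ01 n t).1 (hθ01 n t).2
    have hw0 : ∀ n t, t ∉ Icc (δ m) s → η m t * θ n t = 0 := by
      intro n t ht
      by_cases h1 : t ≤ δ m
      · rw [hη0 m t h1, zero_mul]
      · have h2 : s - ε n / 2 ≤ t := by
          by_contra h2
          exact ht ⟨(not_le.1 h1).le, by linarith [hεpos n]⟩
        rw [hθ0 n t h2, mul_zero]
    have hDIs : IntegrableOn D₀ (Icc (δ m) s ×ˢ (univ : Set X)) volume := hD₀I (δ m) s (hδ0 m) hsm.2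
    have iA : ∀ n, Integrable (fun z : ℝ × X => (η m z.1 * θ n z.1) * D₀ z) volume := fun n =>
      integrable_timeWeight_mul hDIs ((hηs m).continuous.mul (hθs n).continuous) (hwb n) (hw0 n)
    have iB : ∀ n, Integrable (fun z : ℝ × X => (ρ m z.1 * θ n z.1) * W₀ z) volume := fun n =>
      integrable_time_mul' hIW (χ := fun t => ρ m t * θ n t) ((hρc m).mul (hθs n).continuous)
        (C := Cρ) fun t => by
        show |ρ m t * θ n t| ≤ Cρ
        rw [abs_mul, abs_of_nonneg (hθ01 n t).1]
        exact (mul_le_of_le_one_right (abs_nonneg _) (hθ01 n t).2).trans (hCρ t)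
    have iC : ∀ n, Integrable (fun z : ℝ × X => (η m z.1 * k n z.1) * W₀ z) volume := fun n =>
      integrable_time_mul' hIW (χ := fun t => η m t * k n t) ((hηs m).continuous.mul (hkc n))
        (C := Ck / ε n) fun t => by
        show |η m t * k n t| ≤ Ck / ε n
        rw [abs_mul]
        calc |η m t| * |k n t| ≤ 1 * |k n t| := by gcongr; exact hηabs m t
          _ ≤ Ck / ε n := by rw [one_mul]; exact hkb n t
    have iE : ∀ n, Integrable (fun z : ℝ × X => (η m z.1 * θ n z.1) * R₀ z) volume := fun n =>
      integrable_time_mul' hIR (χ := fun t => η m t * θ n t) ((hηs m).continuous.mul (hθs n).continuous)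
        (hwb n)
    have iηR : Integrable (fun z : ℝ × X => η m z.1 * R₀ z) volume :=
      integrable_time_mul' hIR (hηs m).continuous (hηabs m)
    have ikW : ∀ n, Integrable (fun z : ℝ × X => k n z.1 * W₀ z) volume := fun n =>
      integrable_time_mul' hIW (hkc n) (hkb n)
    have iρW : Integrable (fun z : ℝ × X => ρ m z.1 * W₀ z) volume :=
      integrable_time_mul' hIW (hρc m) hCρ
    -- ### the tested inequality in terms of the extended data
    have hvan : ∀ n (z : ℝ × X), z ∉ S →
        ρ m z.1 * θ n z.1 = 0 ∧ η m z.1 * k n z.1 = 0 ∧ η m z.1 * θ n z.1 = 0 := by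
      intro n z hz
      have hz1 : z.1 ∉ Ioo (0 : ℝ) T₀ := fun h => hz ⟨h, mem_univ _⟩
      rcases le_or_gt z.1 0 with h0 | h0
      · have hη : η m z.1 = 0 := hη0 m z.1 (h0.trans (hδ0 m).le)
        have hρ : ρ m z.1 = 0 := hρsupp m z.1 fun h => by linarith [h.1, hδ0 m]
        simp [hη, hρ]
      · have hT : T₀ ≤ z.1 := by
          by_contra h
          exact hz1 ⟨h0, not_le.1 h⟩
        have hρ : ρ m z.1 = 0 := hρsupp m z.1 fun h => by linarith [h.2, hδT m]
        have hθ : θ n z.1 = 0 := hθ0 n z.1 (by linarith [hεpos n, hsm.2])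
        have hk : k n z.1 = 0 := by
          by_contra h
          have := (hks n z.1 h).2
          linarith [hεpos n, hsm.2]
        simp [hρ, hθ, hk]
    have hχ' : ∀ n, 2 * ∫ z : ℝ × X, (η m z.1 * θ n z.1) * D₀ z ≤
        (∫ z : ℝ × X, (ρ m z.1 * θ n z.1) * W₀ z) - (∫ z : ℝ × X, (η m z.1 * k n z.1) * W₀ z) +
          ∫ z : ℝ × X, (η m z.1 * θ n z.1) * R₀ z := by
      intro n
      have h := hχ n
      have e1 : ∫ z : ℝ × X, (η m z.1 * θ n z.1) * D z = ∫ z : ℝ × X, (η m z.1 * θ n z.1) * D₀ z := by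
        refine integral_congr_ae (Eventually.of_forall fun z => ?_)
        dsimp only
        by_cases hz : z ∈ S
        · rw [hDS z hz]
        · rw [(hvan n z hz).2.2, zero_mul, zero_mul]
      have e2 : ∫ z : ℝ × X, ((ρ m z.1 * θ n z.1 - η m z.1 * k n z.1) * W z + (η m z.1 * θ n z.1) * R z) =
          ∫ z : ℝ × X, ((ρ m z.1 * θ n z.1) * W₀ z - (η m z.1 * k n z.1) * W₀ z +
            (η m z.1 * θ n z.1) * R₀ z) := by
        refine integral_congr_ae (Eventually.of_forall fun z => ?_)
        dsimp only
        by_cases hz : z ∈ S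
        · rw [hWS z hz, hRS z hz]; ring
        · obtain ⟨h1, h2, h3⟩ := hvan n z hz
          rw [h1, h2, h3]; ring
      have iBC : Integrable (fun z : ℝ × X => (ρ m z.1 * θ n z.1) * W₀ z - (η m z.1 * k n z.1) * W₀ z)
          volume := (iB n).sub (iC n)
      rw [e1, e2, integral_add iBC (iE n), integral_sub (iB n) (iC n)] at h
      exact h
    -- ### the limits `n → ∞`
    -- an index beyond which the top cut-off acts above `3δ_m`
    have hevN : ∀ᶠ n in atTop, 3 * δ m ≤ s - 2 * ε n := by
      have h2 : Tendsto (fun n => s - 2 * ε n) atTop (𝓝 (s - 2 * 0)) :=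
        tendsto_const_nhds.sub (hε0.const_mul 2)
      rw [mul_zero, sub_zero] at h2
      exact (tendsto_order.1 h2).1 _ hsm.1 |>.mono fun n hn => hn.le
    -- (B) the datum-side term is eventually constant
    have hB : ∀ᶠ n in atTop, ∫ z : ℝ × X, (ρ m z.1 * θ n z.1) * W₀ z = ∫ z : ℝ × X, ρ m z.1 * W₀ z := by
      filter_upwards [hevN] with n hn
      refine integral_congr_ae (Eventually.of_forall fun z => ?_)
      dsimp only
      by_cases hz : z.1 ∈ Ioo (δ m) (3 * δ m)
      · rw [hθ1 n z.1 (by linarith [hz.2]), mul_one]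
      · rw [hρsupp m z.1 hz, zero_mul, zero_mul]
    have hBU : ∫ z : ℝ × X, ρ m z.1 * W₀ z = ∫ t, ρ m t * U t := by
      rw [hprod, integral_prod _ (by rw [← hprod]; exact iρW)]
      refine integral_congr_ae (Eventually.of_forall fun t => ?_)
      simp only [hU, ← integral_const_mul]
    -- (C) the kernel term tends to `U s`
    have hC : ∀ᶠ n in atTop, ∫ z : ℝ × X, (η m z.1 * k n z.1) * W₀ z = ∫ t, k n t * U t := by
      filter_upwards [hevN] with n hn
      have e1 : ∫ z : ℝ × X, (η m z.1 * k n z.1) * W₀ z = ∫ z : ℝ × X, k n z.1 * W₀ z := by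
        refine integral_congr_ae (Eventually.of_forall fun z => ?_)
        dsimp only
        by_cases hz : k n z.1 = 0
        · rw [hz, mul_zero, zero_mul]
        · rw [hη1 m z.1 (hn.trans (hks n z.1 hz).1), one_mul]
      rw [e1, hprod, integral_prod _ (by rw [← hprod]; exact ikW n)]
      refine integral_congr_ae (Eventually.of_forall fun t => ?_)
      simp only [hU, ← integral_const_mul]
    have hlimC : Tendsto (fun n => ∫ t, k n t * U t) atTop (𝓝 (U s)) :=
      tendsto_integral_kernel_mul_of_lebesguePoint hIU (fun w δ' hδ' hm' => hs w δ' hδ' hm') hεpos hε0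
        hkc hkb hks hk1
    -- (E) the flux term
    have hlimE : Tendsto (fun n => ∫ z : ℝ × X, (η m z.1 * θ n z.1) * R₀ z) atTop
        (𝓝 (∫ z in {z : ℝ × X | z.1 < s}, η m z.1 * R₀ z)) := by
      rw [← integral_indicator (hmeasI s)]
      refine tendsto_integral_of_dominated_convergence (fun z => ‖η m z.1 * R₀ z‖)
        (fun n => (iE n).aestronglyMeasurable) iηR.norm
        (fun n => Eventually.of_forall fun z => ?_) (Eventually.of_forall fun z => ?_)
      · rw [mul_comm (η m z.1) (θ n z.1), mul_assoc, norm_mul]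
        exact mul_le_of_le_one_left (norm_nonneg _) (by
          rw [Real.norm_eq_abs, abs_of_nonneg (hθ01 n z.1).1]; exact (hθ01 n z.1).2)
      · have := (tendsto_cutoff_indicator hεpos hε0 (hθ1) (hθ0) z.1).mul_const (η m z.1 * R₀ z)
        refine (this.congr' (Eventually.of_forall fun n => by ring)).trans ?_
        by_cases hz : z.1 < s
        · rw [indicator_of_mem (mem_Iio.2 hz), indicator_of_mem (show z ∈ {z : ℝ × X | z.1 < s} from hz),
            one_mul]
        · rw [indicator_of_notMem (fun h' => hz (mem_Iio.1 h')),
            indicator_of_notMem (show z ∉ {z : ℝ × X | z.1 < s} from hz), zero_mul]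
    -- (A) the dissipation dominates the integral over `(3δ_m, s - 2ε_n) × X`, which tends to the
    -- integral over `(3δ_m, s) × X`
    set A' : ℕ → ℝ := fun n => ∫ z in Ioo (3 * δ m) (s - 2 * ε n) ×ˢ (univ : Set X), D₀ z with hA'
    have hAle : ∀ n, A' n ≤ ∫ z : ℝ × X, (η m z.1 * θ n z.1) * D₀ z := by
      intro n
      have hsub : Ioo (3 * δ m) (s - 2 * ε n) ×ˢ (univ : Set X) ⊆ Icc (δ m) s ×ˢ (univ : Set X) :=
        prod_mono (fun t ht => ⟨by linarith [ht.1, hδ0 m], by linarith [ht.2, hεpos n]⟩) Subset.rfl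
      show (∫ z in Ioo (3 * δ m) (s - 2 * ε n) ×ˢ (univ : Set X), D₀ z) ≤ _
      rw [← integral_indicator (measurableSet_Ioo.prod MeasurableSet.univ)]
      refine integral_mono ((hDIs.mono_set hsub).integrable_indicator
        (measurableSet_Ioo.prod MeasurableSet.univ)) (iA n) fun z => ?_
      by_cases hz : z ∈ Ioo (3 * δ m) (s - 2 * ε n) ×ˢ (univ : Set X)
      · rw [indicator_of_mem hz, hη1 m z.1 hz.1.1.le, hθ1 n z.1 hz.1.2.le, one_mul, one_mul]
      · rw [indicator_of_notMem hz]
        exact mul_nonneg (mul_nonneg (hη01 m z.1).1 (hθ01 n z.1).1) (hD₀0 z)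
    have hlimA : Tendsto A' atTop (𝓝 (∫ z in Ioo (3 * δ m) s ×ˢ (univ : Set X), D₀ z)) := by
      have hεanti : ∀ n n' : ℕ, n ≤ n' → ε n' ≤ ε n := fun n n' hnn' => by
        show 1 / ((n' : ℝ) + 1) ≤ 1 / ((n : ℝ) + 1)
        exact div_le_div_of_nonneg_left zero_le_one (by positivity)
          (by have : (n : ℝ) ≤ n' := Nat.cast_le.2 hnn'; linarith)
      have hmono : Monotone fun n => Ioo (3 * δ m) (s - 2 * ε n) ×ˢ (univ : Set X) := fun n n' hnn' =>
        prod_mono (Ioo_subset_Ioo_right (by linarith [hεanti n n' hnn'])) Subset.rfl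
      have hU' : (⋃ n, Ioo (3 * δ m) (s - 2 * ε n) ×ˢ (univ : Set X)) = Ioo (3 * δ m) s ×ˢ (univ : Set X) := by
        ext z
        simp only [mem_iUnion, mem_prod, mem_Ioo, mem_univ, and_true]
        constructor
        · rintro ⟨n, h1, h2⟩
          exact ⟨h1, by linarith [hεpos n]⟩
        · rintro ⟨h1, h2⟩
          have h2' : Tendsto (fun n => s - 2 * ε n) atTop (𝓝 (s - 2 * 0)) :=
            tendsto_const_nhds.sub (hε0.const_mul 2)
          rw [mul_zero, sub_zero] at h2'
          obtain ⟨n, hn⟩ := ((tendsto_order.1 h2').1 _ h2).exists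
          exact ⟨n, h1, hn⟩
      have hI : IntegrableOn D₀ (⋃ n, Ioo (3 * δ m) (s - 2 * ε n) ×ˢ (univ : Set X)) volume := by
        rw [hU']
        exact hDIs.mono_set (prod_mono (fun t ht => ⟨by linarith [ht.1, hδ0 m], ht.2.le⟩) Subset.rfl)
      have h := tendsto_setIntegral_of_monotone (μ := (volume : Measure (ℝ × X)))
        (fun n => measurableSet_Ioo.prod MeasurableSet.univ) hmono hI
      rw [hU'] at h
      exact h
    -- ### pass to the limit `n → ∞`
    have hineq : ∀ᶠ n in atTop, (∫ t, k n t * U t) + 2 * A' n ≤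
        (∫ t, ρ m t * U t) + ∫ z : ℝ × X, (η m z.1 * θ n z.1) * R₀ z := by
      filter_upwards [hB, hC] with n hBn hCn
      have h := hχ' n
      rw [hBn, hBU, hCn] at h
      linarith [hAle n]
    exact le_of_tendsto_of_tendsto (hlimC.add (hlimA.const_mul 2)) (tendsto_const_nhds.add hlimE) hineq
  -- ## the limit `m → ∞`
  have hlimB : Tendsto (fun m => ∫ t, ρ m t * U t) atTop (𝓝 L) := by
    have e : ∀ m, ∫ t, ρ m t * U t = ∫ t in Ioo 0 T₀, ρ m t * U t := by
      intro m
      refine (setIntegral_eq_integral_of_forall_compl_eq_zero fun t ht => ?_).symm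
      rw [hρsupp m t (fun h => ht ⟨(hδ0 m).trans h.1, h.2.trans_le (hδT m)⟩), zero_mul]
    simp only [e]
    exact tendsto_setIntegral_mul_of_ae_tendsto hIU.integrableOn hlimU hδlim hδ0 hδT hρc hρ0 hρsupp hρ1
  rw [ae_restrict_iff' measurableSet_Ioo]
  filter_upwards [hlevel] with s hs hsI
  have hevm : ∀ᶠ m in atTop, 3 * δ m < s := by
    have h3 : Tendsto (fun m => 3 * δ m) atTop (𝓝 0) := by simpa using hδlim.const_mul 3
    exact (tendsto_order.1 h3).2 _ hsI.1
  -- the flux: dominated convergence as `η_m ↑ 1` on `(0, ∞)`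
  have hRs : ∫ z in Ioo 0 s ×ˢ (univ : Set X), R z = ∫ z in Ioo 0 s ×ˢ (univ : Set X), R₀ z := by
    refine setIntegral_congr_fun (measurableSet_Ioo.prod MeasurableSet.univ) fun z hz => ?_
    exact (hRS z ⟨⟨hz.1.1, hz.1.2.trans hsI.2⟩, mem_univ _⟩).symm
  have hlimR : Tendsto (fun m => ∫ z in {z : ℝ × X | z.1 < s}, η m z.1 * R₀ z) atTop
      (𝓝 (∫ z in Ioo 0 s ×ˢ (univ : Set X), R z)) := by
    rw [hRs, ← integral_indicator (measurableSet_Ioo.prod MeasurableSet.univ)]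
    have e : ∀ m, ∫ z in {z : ℝ × X | z.1 < s}, η m z.1 * R₀ z =
        ∫ z, {z : ℝ × X | z.1 < s}.indicator (fun z => η m z.1 * R₀ z) z :=
      fun m => (integral_indicator (hmeasI s)).symm
    simp only [e]
    refine tendsto_integral_of_dominated_convergence (fun z => ‖R₀ z‖)
      (fun m => ((integrable_time_mul' hIR (hηs m).continuous (hηabs m)).indicator
        (hmeasI s)).aestronglyMeasurable) hIR.norm
      (fun m => Eventually.of_forall fun z => ?_) (Eventually.of_forall fun z => ?_)
    · refine (norm_indicator_le_norm_self _ _).trans ?_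
      rw [norm_mul, Real.norm_eq_abs]
      exact mul_le_of_le_one_left (norm_nonneg _) (hηabs m z.1)
    · by_cases hz : z ∈ Ioo 0 s ×ˢ (univ : Set X)
      · rw [indicator_of_mem hz]
        have hzs : z ∈ {z : ℝ × X | z.1 < s} := hz.1.2
        have hev : ∀ᶠ m in atTop, {z : ℝ × X | z.1 < s}.indicator (fun z => η m z.1 * R₀ z) z = R₀ z := by
          have h3 : Tendsto (fun m => 3 * δ m) atTop (𝓝 0) := by simpa using hδlim.const_mul 3
          filter_upwards [(tendsto_order.1 h3).2 _ hz.1.1] with m hm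
          rw [indicator_of_mem hzs, hη1 m z.1 hm.le, one_mul]
        exact tendsto_const_nhds.congr' (hev.mono fun m hm => hm.symm)
      · rw [indicator_of_notMem hz]
        by_cases hz' : z.1 < s
        · -- `z.1 ≤ 0` (as `z.2 ∈ univ`): there `η_m = 0`
          have hz0 : z.1 ≤ 0 := by
            by_contra h
            exact hz ⟨⟨not_le.1 h, hz'⟩, mem_univ _⟩
          have e0 : ∀ m, {z : ℝ × X | z.1 < s}.indicator (fun z => η m z.1 * R₀ z) z = 0 := fun m => by
            rw [indicator_of_mem (show z ∈ {z : ℝ × X | z.1 < s} from hz'), hη0 m z.1 (hz0.trans (hδ0 m).le),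
              zero_mul]
          simp only [e0]
          exact tendsto_const_nhds
        · have e0 : ∀ m, {z : ℝ × X | z.1 < s}.indicator (fun z => η m z.1 * R₀ z) z = 0 := fun m =>
            indicator_of_notMem (show z ∉ {z : ℝ × X | z.1 < s} from hz') _
          simp only [e0]
          exact tendsto_const_nhds
  -- the dissipation: the integrals over `(3δ_m, s) × X` increase to the one over `(0, s) × X`
  set b : ℕ → ℝ≥0∞ := fun m => ∫⁻ z in Ioo (3 * δ m) s ×ˢ (univ : Set X), ENNReal.ofReal (D₀ z) with hb
  have hδanti : ∀ m m' : ℕ, m ≤ m' → δ m' ≤ δ m := fun m m' hmm' => by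
    show T₀ / (8 * ((m' : ℝ) + 1)) ≤ T₀ / (8 * ((m : ℝ) + 1))
    exact div_le_div_of_nonneg_left hT₀.le (by positivity)
      (by have : (m : ℝ) ≤ m' := Nat.cast_le.2 hmm'; nlinarith)
  have hbmono : Monotone b := fun m m' hmm' =>
    lintegral_mono_set (prod_mono (Ioo_subset_Ioo_left (by linarith [hδanti m m' hmm'])) Subset.rfl)
  have hUnion : (⋃ m, Ioo (3 * δ m) s ×ˢ (univ : Set X)) = Ioo 0 s ×ˢ (univ : Set X) := by
    ext z
    simp only [mem_iUnion, mem_prod, mem_Ioo, mem_univ, and_true]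
    constructor
    · rintro ⟨m, h1, h2⟩
      exact ⟨lt_trans (by linarith [hδ0 m]) h1, h2⟩
    · rintro ⟨h1, h2⟩
      have h3δ : Tendsto (fun m => 3 * δ m) atTop (𝓝 0) := by simpa using hδlim.const_mul 3
      obtain ⟨m, hm⟩ := ((tendsto_order.1 h3δ).2 _ h1).exists
      exact ⟨m, hm, h2⟩
  have hdir : Directed (· ⊆ ·) fun m => Ioo (3 * δ m) s ×ˢ (univ : Set X) :=
    Monotone.directed_le fun m m' hmm' =>
      prod_mono (Ioo_subset_Ioo_left (by linarith [hδanti m m' hmm'])) Subset.rfl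
  have hsup : ∫⁻ z in Ioo 0 s ×ˢ (univ : Set X), ENNReal.ofReal (D z) = ⨆ m, b m := by
    have e : ∫⁻ z in Ioo 0 s ×ˢ (univ : Set X), ENNReal.ofReal (D z) =
        ∫⁻ z in Ioo 0 s ×ˢ (univ : Set X), ENNReal.ofReal (D₀ z) := by
      refine setLIntegral_congr_fun (measurableSet_Ioo.prod MeasurableSet.univ) fun z hz => ?_
      rw [hDS z ⟨⟨hz.1.1, hz.1.2.trans hsI.2⟩, mem_univ _⟩]
    rw [e, ← hUnion]
    exact setLIntegral_iUnion_of_directed _ hdir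
  -- the real dissipation integrals as lower integrals
  have hbreal : ∀ m, 3 * δ m < s → ENNReal.ofReal (∫ z in Ioo (3 * δ m) s ×ˢ (univ : Set X), D₀ z) = b m := by
    intro m hm
    have hI : IntegrableOn D₀ (Ioo (3 * δ m) s ×ˢ (univ : Set X)) volume :=
      (hD₀I (δ m) s (hδ0 m) hsI.2).mono_set (prod_mono (fun t ht => ⟨by linarith [ht.1, hδ0 m], ht.2.le⟩)
        Subset.rfl)
    rw [hb]
    exact ofReal_integral_eq_lintegral_ofReal hI (Eventually.of_forall fun z => hD₀0 z)
  rw [hsup, ENNReal.mul_iSup, ENNReal.add_iSup]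
  refine iSup_le fun m₀ => ?_
  have hUs : U s = ∫ x, W (s, x) := hUW s hsI
  have key : ∀ᶠ m in atTop, ENNReal.ofReal (∫ x, W (s, x)) + 2 * b m₀ ≤
      ENNReal.ofReal (∫ t, ρ m t * U t) + ENNReal.ofReal (∫ z in {z : ℝ × X | z.1 < s}, η m z.1 * R₀ z) := by
    filter_upwards [hevm, eventually_ge_atTop m₀] with m hm hmm₀
    have h := hs m ⟨hm, hsI.2⟩
    have hA0 : 0 ≤ ∫ z in Ioo (3 * δ m) s ×ˢ (univ : Set X), D₀ z :=
      integral_nonneg fun z => hD₀0 z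
    calc ENNReal.ofReal (∫ x, W (s, x)) + 2 * b m₀
        ≤ ENNReal.ofReal (∫ x, W (s, x)) + 2 * b m := add_le_add le_rfl (mul_le_mul' le_rfl (hbmono hmm₀))
      _ = ENNReal.ofReal (U s + 2 * ∫ z in Ioo (3 * δ m) s ×ˢ (univ : Set X), D₀ z) := by
          rw [← hUs, ← hbreal m hm, ENNReal.ofReal_add (hU0 s) (by positivity),
            ENNReal.ofReal_mul zero_le_two, ENNReal.ofReal_ofNat]
      _ ≤ ENNReal.ofReal ((∫ t, ρ m t * U t) + ∫ z in {z : ℝ × X | z.1 < s}, η m z.1 * R₀ z) :=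
          ENNReal.ofReal_le_ofReal h
      _ ≤ _ := ENNReal.ofReal_add_le
  have hlimit : Tendsto (fun m => ENNReal.ofReal (∫ t, ρ m t * U t) +
      ENNReal.ofReal (∫ z in {z : ℝ × X | z.1 < s}, η m z.1 * R₀ z)) atTop
      (𝓝 (ENNReal.ofReal L + ENNReal.ofReal (∫ z in Ioo 0 s ×ˢ (univ : Set X), R z))) :=
    ((ENNReal.continuous_ofReal.tendsto L).comp hlimB).add
      ((ENNReal.continuous_ofReal.tendsto _).comp hlimR)
  exact ge_of_tendsto hlimit key

end JiaSverak2014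

end Literature.Analysis.FluidPDE

end
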